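import Mathlib
import Literature.Computability.Cryptography.QubitRegister
import Literature.Computability.Cryptography.QuantumCircuit
import Literature.Computability.QuantumComplexity.PauliExpansion
import Literature.Barriers.QuantumAdvantage.BoundedEntanglement
import HarnessLib

/-!
# Barrier catalogue `QuantumAdvantage` — no free frame: uniform Clifford+T families whose states have exponential bond dimension in EVERY Clifford frame

Topic `Literature/Barriers/QuantumAdvantage` (D-0021). Summit statement:
`QuantumAdvantage := ∃ L, L ∈ BQP ∧ L ∉ BPP`.

The MAIN entry of six that file the PROVED bounds of the retired route `SymplecticPurity`
(`Summits/QuantumAdvantage/QuantumAdvantage/Theses/SymplecticPurity.lean`; thesis `X = (BQP ⊆ BPP)`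
reached by the FREE-FRAME ROAD, a route that "existed for its kills"; closed `retired` on the human
ruling of 2026-08-16 "file the proven bounds as barriers, let the open pair go") as barrier items:
`NoFreeFrame` (this file, fact `noFreeFrame` = `¬ H_FF`, the complexity-level kill),
`NoFreeFramePurityBound` (`symplecticPurityBound`: flat spectrum ⇒ low-purity cut in every Clifford
frame, ancilla-robust), `NoFreeFrameGaussianBound` (`gaussianDegreeBound`: the matchgate analogue),
`NoFreeFrameSBoxSpectrum` (`graphStateSpectrum`: Pauli spectrum of `Σ|x⟩|f x⟩` = differential/linear
profile of `f`), `NoFreeFrameCubeAlmostBent` (`cubeAlmostBent`: `x³` is APN and near-bent),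
`NoFreeFrameCubeGraphFlat` (`cubeGraphFlat`: the explicit `2^{1−n/2}`-flat family). The two cruxes
the route left UNDECIDED are recorded in `evasions_known`: `DlogGraphFlat` (stmt-QuantumAdvantage-10732:
is Shor's own data state `Σ|x⟩|g^x mod p⟩` flat?) and `CompositeFrameBound`
(stmt-QuantumAdvantage-10730: do depth-3 Clifford∘Gaussian∘Clifford frames compress the cube state?).
The six files are independent (no mutual imports).

BARRIER: technique_class := THE FREE-FRAME ROAD to dequantisation — simulate uniform
  polynomial-time Clifford+T computations by keeping every intermediate state as
  (free Clifford frame) · (matrix-product state of polynomial bond dimension): Clifford-augmented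
  MPS / DMRG / TDVP [cite: QianHuangQin2024] [cite: QianHuangQin2024TDVP] [cite: HuangQianQin2024Fermion]
  [cite: YosprakobEtAl2025], optimisation-free / optimisation-based Clifford disentangling
  [cite: LiuClark2024, §2] [cite: FuxEtAl2024, Thm. 1], Clifford entanglement cooling of tensor
  networks [cite: MasotllimaEtAl2026, §I]; undo the frame by stabilizer simulation
  [cite: AaronsonGottesman2004, §III] and contract the MPS [cite: Vidal2003, Thm. 1]. Formally the
  hypothesis `H_FF` (purity form, the WEAKEST natural reading, so that its negation is strongest):
  every uniform oracle-free Clifford+T family `F` admits `c` such that for every input `x` and stage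
  `j` SOME Clifford unitary `U` on the `|x| + ancillas` wires gives `U · (F.stateAfter x j)` purity
  `≥ 1/(|x|^c + c)` across EVERY linear cut;
  blocks := `H_FF` itself — it is FALSE (`noFreeFrame`): there is a uniform, oracle-free Clifford+T
  family (Hadamards loading `Σ_y |y⟩`, then `O(n²)` Toffoli/CNOT gates computing `y ↦ y³` in
  `𝔽₂[X]/(Φ_{3^{k+1}}) ≅ 𝔽_{2ⁿ}`, `n = 2·3^k`) whose final state on input `0ⁿ` has, in EVERY
  Clifford frame, a linear cut of purity `≤ 5·2^{−n/2}` — bond dimension `≥ 2^{n/2}/5` — so no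
  argument of the shape "every BQP computation is free-frame representable with polynomial bonds,
  hence `BQP ⊆ BPP`" can be sound, and every free-frame dequantisation must either restrict the
  circuit class or leave the free-frame technique class; on the positive side this quantifies, for an
  explicit family, where "magic and entanglement become inextricable", the regime the CAMPS
  literature asks about [cite: LiuClark2024, §6] [cite: FuxEtAl2024, Thm. 1 (disentangling for t ≲ N)]
  [cite: MasotllimaEtAl2026, Thm. III.1 (one-qubit qualitative no-go)]; it complements the
  catalogue's `jozsaLinden2003_pblocked` (`BoundedEntanglement.lean`: bounded multipartite
  entanglement ⇒ `BPP`) from the other side — entanglement that no free re-framing removes;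
  because := (1) the family is polynomial-time uniform and oracle-free (its description is computed
  by the tree's `CodeFP` algebra; Toffoli and CNOT are exact Clifford+T gates of the tree's gate set);
  (2) on input `0ⁿ` its final state is the normalised graph state `2^{−n/2} Σ_y |y⟩|y³⟩` of the cube
  map of the field `𝔽₂[X]/(X^{2·3^k} + X^{3^k} + 1)` (the `3^{k+1}`-st cyclotomic polynomial is
  irreducible over `𝔽₂` because `2` is a primitive root modulo `3^{k+1}`); (3) that state is
  `ε`-flat with `ε = 2·2^{−n/2}` — the S-box dictionary with `D = 2`, `Λ ≤ 2√2ⁿ` for the APN,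
  near-bent cube map [cite: Carlet2020, §11.5.2 (PDF p. 497) and PDF pp. 222–223] [cite: Nyberg1994]
  (`graphStateSpectrum`, `cubeAlmostBent`, `cubeGraphFlat`); (4) a unit `ε`-flat state has, in every
  semantic Clifford frame, purity `≤ 2^{−h} + 2^{h} ε²` across the linear cut `h` (Pauli-spectral
  mass on a cut, permuted up to phase by the frame [cite: AaronsonGottesman2004, §III]; the
  ancilla-free case of `symplecticPurityBound`, whose general case uses the stabilizer cleaning count
  [cite: FattalEtAl2004, Thm. 1]), here `5·2^{−n/2}` at `h = n/2`; (5) `5·2^{−3^k} < 1/((2·3^k)^c + c)`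
  for large `k` — all machine-checked in this tree (see `status`);
  evasions_known := (a) RESTRICTED circuit classes on which free frames provably or empirically
  suffice — `t ≲ N` non-Clifford gates [cite: FuxEtAl2024, Thm. 1 and Fig. 1] [cite: LiuClark2024, §2–§3],
  shallow or weakly-magical dynamics; `noFreeFrame` only says the road cannot cover ALL uniform
  families; (b) NON-FREE or COMPOSITE frames — frames containing non-Clifford gates, or
  Clifford ∘ matchgate ∘ Clifford alternation [cite: HuangEtAl2025]: UNDECIDED for the witness (the
  retired route's open crux `CompositeFrameBound`, stmt-QuantumAdvantage-10730; the pure-Clifford and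
  pure-Gaussian layers are each covered, `symplecticPurityBound` / `gaussianDegreeBound`, but the
  bounds do not iterate because flatness is basis-dependent); (c) ALGORITHM-SPECIFIC dequantisation —
  `H_FF` quantifies over all uniform families; whether the states of a SPECIFIC algorithm of interest
  are free-frame compressible is untouched, and for Shor's modular exponentiation it is exactly the
  retired route's other open crux `DlogGraphFlat` (stmt-QuantumAdvantage-10732: flatness of
  `Σ_x |x⟩|g^x mod p⟩` off the `2`-adic resonance locus; refuter evidence on the item shows exact
  resonances `2^{n−1}` at Mersenne `p`, and MPS simulations of Shor exist at small sizes
  [cite: WangHillHollenberg2015]); (d) APPROXIMATE representations — `H_FF` asks for exact purity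
  bounds; an `ε`-truncated road must still carry Schmidt mass spread over `≥ 2^{n/2}/5` levels at the
  bad cut, but the robust statement is NOT vendored; (e) simulators outside the frame-plus-MPS
  representability (stabilizer-rank / extent decompositions, Pauli back-propagation, treewidth
  contraction — see `TensorNetworkContraction.lean` — quasi-probability sampling) are different
  technique classes with their own entries and routes; (f) the witness is ONE input (`0ⁿ`) at the
  FINAL stage; nothing is claimed about average inputs or about intermediate stages of other families;
  scope_caveats := (i) `H_FF` is typed non-uniformly (existence of a frame per `(x, j)`, no
  efficiency asked of the frame-finder) and in purity form over LINEAR cuts of the frame's wire order —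
  all orders are covered since permutations are Clifford; (ii) the frame acts on exactly the family's
  `|x| + F.ancillas |x|` wires: EXTRA stabilizer ancillas inside the frame are not part of the typed
  `H_FF`, but are excluded quantitatively by the ancilla-robust `symplecticPurityBound` (any `m`);
  (iii) "Clifford" is SEMANTIC (`U` unitary, `U σ_S U† = c σ_{S'}`, `‖c‖ = 1`), which contains every
  `T`-free circuit of the tree's gate set `cliffordT`; (iv) `F.stateAfter x j` is the catalogue's
  (`BoundedEntanglement.lean`) state after the first `j` gates on input `|x⟩|0…0⟩`, empty oracle;
  (v) `1/(|x|^c + c)` with `c : ℕ` is the `1/poly` threshold (`c` also bounds the additive constant);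
  (vi) the negation is of the displayed `∀ F …` statement verbatim — no claim about `BQP` vs `BPP`
  themselves is made (the route's thesis `X = (BQP ⊆ BPP)`, item stmt-QuantumAdvantage-0242, stays
  open and shared with seven other routes);
  status := theorem — MACHINE-CHECKED IN THIS TREE, Summits side:
  `Summit.QuantumAdvantage.QuantumAdvantage.Theorems.SymplecticPurity.noFreeFrame_proof` (files
  `Summits/QuantumAdvantage/QuantumAdvantage/Theorems/SymplecticPurityNoFreeFrame.lean`,
  `…NoFreeFrame{Purity,Uniform,Coord,Family,Cyclo}.lean`, `…SymplecticPurityDefs.lean` and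
  `…CubeGraphFlat{,Field}.lean`, ≈ 2 000 lines, standard axioms) closed item
  stmt-QuantumAdvantage-10731 of route `SymplecticPurity`; typed below as a NAMED FACT only because
  `Literature` may not import `Summits` (CONVENTIONS §2): the body is token for token the route decl
  `Summit.QuantumAdvantage.QuantumAdvantage.Theses.SymplecticPurity.NoFreeFrame` (definitionally
  equal, `Iff.rfl`, and discharged by `exact noFreeFrame_proof` in the filing planner's scratch check,
  2026-08-16), so the discharge of record is the ONE-LINE Summits-side
  `theorem noFreeFrame_holds : Literature.Barriers.QuantumAdvantage.noFreeFrame :=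
  Summit.QuantumAdvantage.QuantumAdvantage.Theorems.SymplecticPurity.noFreeFrame_proof` — do NOT
  re-prove it in `Literature`. Not in print: the CAMPS corpus proves free frames WORK for `t ≲ N`
  and poses the inextricability question [cite: LiuClark2024, §6] [cite: FuxEtAl2024, Thm. 1]
  [cite: MasotllimaEtAl2026, Thm. III.1]; route novelty audit 2026-08-15: new-combination.

## Contents

* `noFreeFrame` — THE BARRIER FACT of this file (the only declaration): `¬ H_FF`.

## Design notes

* One named fact, no other declaration (D-0026 / `lint.fact-fanout`). Written over the catalogue's
  own `QCircuitFamily.stateAfter` (`BoundedEntanglement.lean`), the circuit library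
  (`QCircuitFamily`, `cliffordT`, `IsOracleFree`, `IsUniform`, `ancillas` —
  `Literature/Computability/Cryptography/QuantumCircuit.lean`), `QReg` and `Pauli`/`pauliString`,
  token for token the route decl so that the tree theorem discharges it by `exact`;
  `open scoped Classical` matches the route file's elaboration context.
* The negand keeps the route's binder names (the inner `∃ c : ℂ` phase shadows the outer exponent
  `c : ℕ` only inside its conjunct, exactly as in the route decl).
* Why a barrier and not only a closed route item: CONVENTIONS §7 makes `route open` / `idea add`
  address catalogued barriers of their technique class; every future dequantisation card on this
  summit that re-frames states with free operations must now say how it evades `noFreeFrame`.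

## References

* [LiuClark2024] Z. Liu, B. K. Clark, *Classical simulability of Clifford+T circuits with
  Clifford-augmented matrix product states*, arXiv:2412.17209: §2 (OFD/OBD), §3, §6. Read.
* [FuxEtAl2024] G. E. Fux, B. Béri, R. Fazio, E. Tirrito, *Disentangling magic states with
  classically simulable quantum circuits*, PRL 135, 260605 (arXiv:2410.09001): Thm. 1, Fig. 1. Read.
* [MasotllimaEtAl2026] S. Masot-Llima, P. Sierant, P. Stornati, A. Garcia-Saez, *Limits of Clifford
  disentangling in tensor network states*, arXiv:2602.15942: §I, Thm. III.1. Read.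
* [QianHuangQin2024] X. Qian, J. Huang, M. Qin, PRL 133, 190402 (arXiv:2405.09217);
  [QianHuangQin2024TDVP] arXiv:2407.03202; [HuangQianQin2024Fermion] arXiv:2501.00413;
  [HuangEtAl2025] arXiv:2505.08635; [YosprakobEtAl2025] arXiv:2510.04164 — the CAMPS corpus.
* [AaronsonGottesman2004] Phys. Rev. A 70, 052328, §III. [Vidal2003] PRL 91, 147902, Thm. 1 (read).
  [FattalEtAl2004] arXiv:quant-ph/0406168, Thm. 1 (read). [Carlet2020] CUP 2021, §11.5.2, pp. 222–223
  (read). [Nyberg1994] EUROCRYPT '93. [WangHillHollenberg2015] arXiv:1501.07644.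
-/

namespace Literature.Barriers.QuantumAdvantage

open scoped BigOperators Matrix ComplexConjugate Classical
open Literature.Computability.Cryptography Literature.Computability.QuantumComplexity

/-- **No free frame (`¬ H_FF`).** It is FALSE that every polynomial-time uniform, oracle-free
Clifford+T family `F` admits an exponent `c` such that, for every input `x` and every stage `j`,
some unitary `U` on the `|x| + F.ancillas |x|` wires normalising the Pauli group up to unit phases
(a semantic Clifford frame) makes EVERY linear cut `{wires < k}` of `U · (F.stateAfter x j)` have
purity (four-fold agreement sum) `≥ 1/(|x|^c + c)`. Witness: the family loading `Σ_y |y⟩` and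
computing `y ↦ y³` in `𝔽₂[X]/(Φ_{3^{k+1}})`, `n = |x| = 2·3^k`, on input `0ⁿ`, final stage: every
Clifford frame has a cut of purity `≤ 5·2^{−n/2}`.
- technique_class: the free-frame road — (Clifford frame) · (poly-bond MPS) representations of the
  states of uniform BQP computations (CAMPS / Clifford-DMRG / Clifford-TDVP / stabilizer tensor
  networks / Clifford disentangling), then Gottesman–Knill + MPS contraction
- blocks: `H_FF` as displayed, hence any "`BQP ⊆ BPP` via free re-framing of all uniform
  families" argument; quantifies the inextricability regime asked for in [cite: LiuClark2024, §6]
  beyond the `t ≲ N` disentangling theorem [cite: FuxEtAl2024, Thm. 1] and the one-qubit no-go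
  [cite: MasotllimaEtAl2026, Thm. III.1]
- because: uniform Toffoli/CNOT cube family; final state = normalised cube graph state,
  `2^{1−n/2}`-flat (`cubeGraphFlat`, `cubeAlmostBent` [cite: Carlet2020, §11.5.2 (PDF p. 497)],
  `graphStateSpectrum`); flat ⇒ cut `n/2` has purity `≤ 2^{−n/2} + 2^{n/2} ε² = 5·2^{−n/2}` in every
  Clifford frame (`symplecticPurityBound`, [cite: AaronsonGottesman2004, §III]
  [cite: FattalEtAl2004, Thm. 1]); `5·2^{−3^k} < 1/((2·3^k)^c + c)` eventually
- evasions_known: restricted circuit classes (`t ≲ N` magic gates [cite: FuxEtAl2024, Thm. 1]);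
  non-free / composite Clifford∘Gaussian∘Clifford frames [cite: HuangEtAl2025] (undecided ex-crux
  `CompositeFrameBound`, stmt-QuantumAdvantage-10730); algorithm-specific states, e.g. Shor's
  `Σ|x⟩|g^x mod p⟩` (undecided ex-crux `DlogGraphFlat`, stmt-QuantumAdvantage-10732;
  [cite: WangHillHollenberg2015]); approximate roads (robust version not vendored); simulators that
  are not frame+MPS representations
- scope_caveats: weakest `H_FF` (non-uniform frame existence, purity form, linear cuts, frame on
  the family's own wires — extra frame ancillas are handled by `symplecticPurityBound`, not here);
  semantic Clifford; one input `0ⁿ`, final stage; says nothing about `BQP` vs `BPP` (thesis item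
  stmt-QuantumAdvantage-0242 stays open)
- status: theorem, machine-checked in this tree as
  `Summit.QuantumAdvantage.QuantumAdvantage.Theorems.SymplecticPurity.noFreeFrame_proof` (item
  stmt-QuantumAdvantage-10731, route `SymplecticPurity`, retired 2026-08-16); named fact here only
  because `Literature` does not import `Summits` — body definitionally equal to the route decl,
  discharge = the one-line Summits-side `noFreeFrame_holds := …noFreeFrame_proof`
[folklore] -/
def noFreeFrame : Prop :=
  ¬ (∀ F : QCircuitFamily cliffordT, F.IsOracleFree → F.IsUniform → ∃ c : ℕ, ∀ x : List Bool, ∀ j : ℕ,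
      ∃ U : Matrix (QReg (x.length + F.ancillas x.length)) (QReg (x.length + F.ancillas x.length)) ℂ,
        U ∈ Matrix.unitaryGroup (QReg (x.length + F.ancillas x.length)) ℂ ∧
        (∀ S : Fin (x.length + F.ancillas x.length) → Pauli,
          ∃ S' : Fin (x.length + F.ancillas x.length) → Pauli, ∃ c : ℂ,
            ‖c‖ = 1 ∧ U * pauliString S * star U = c • pauliString S') ∧
        ∀ k ≤ x.length + F.ancillas x.length,
          (1 : ℝ) / (x.length ^ c + c) ≤
            ‖∑ x₁ : QReg (x.length + F.ancillas x.length), ∑ x₂ : QReg (x.length + F.ancillas x.length),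
                ∑ x₃ : QReg (x.length + F.ancillas x.length), ∑ x₄ : QReg (x.length + F.ancillas x.length),
              (if (∀ i, k ≤ i.val → x₁ i = x₂ i) ∧ (∀ i, i.val < k → x₂ i = x₃ i) ∧
                  (∀ i, k ≤ i.val → x₃ i = x₄ i) ∧ (∀ i, i.val < k → x₄ i = x₁ i) then
                (U.mulVec (F.stateAfter x j)) x₁ * star ((U.mulVec (F.stateAfter x j)) x₂) *
                  (U.mulVec (F.stateAfter x j)) x₃ * star ((U.mulVec (F.stateAfter x j)) x₄)
              else 0)‖)

end Literature.Barriers.QuantumAdvantage
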